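import Summits.BirchSwinnertonDyer.BirchSwinnertonDyer.Theorems.GenusKolyvaginAtTwoK4NegTwinBsdRoadNonPhantomTwoAdicIff
import Summits.BirchSwinnertonDyer.BirchSwinnertonDyer.Theorems.GenusKolyvaginAtTwoOffCutResidualAtTwoRLw2PhantomExclusionCut
import Summits.BirchSwinnertonDyer.BirchSwinnertonDyer.Theorems.GenusKolyvaginAtTwoGenusDeepSupplyAtTwoNegDiscNarrowKFourCellHalvingDescentKFourNeg
import HarnessLib

/-!
# Route `GenusKolyvaginAtTwo`, K₄⁻ kernel `K4Neg` (stmt-BirchSwinnertonDyer-31526):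
# `(NPh_K)` FROM ONE 2-ADIC BIT (any sign, on or off the cut), AND K₄⁻ ON ITS DEPTH-ONE SUB-CELL MODULO Q2 + THAT BIT — CUT-FREE

Width seat `bsd-line-gk2-p4` g32 (cell `bsd-f1-sign2`), WIDTH-5 attach on route `GenusKolyvaginAtTwo` rev 59.  `--supports stmt-BirchSwinnertonDyer-31526
--as helper`.  THEOREMS ONLY (no definition, no named fact, no `sorry`); standard axioms.  **BSD is NOT proved by this file; `K4Neg` is NOT proved; no
item is closed by it.**  CONDITIONAL on Q2 `KolyvaginRelationAtTwo` (stmt-BirchSwinnertonDyer-24880) and on the 2-ADIC BIT `hbit` (both displayed).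

WHY.  For `Δ > 0` this seat proved `(NPh_K)` on the whole K₄⁺ cell (the real place is the witness) and K₄⁺ at depth one cut-free modulo Q2
(`…K4PosDepthOneTwoSplit`).  For `Δ < 0` the real place is silent and `(NPh_K)` is exactly ONE 2-adic bit of `E` (`…K4NegTwinBsdRoadNonPhantomTwoAdicIff`,
off the cut).  This file composes:
* ★ `nonPhantom_pow_of_twoAdicBit` — ANY sign, ANY habitat curve (`C(E)` odd, `ρ_{E,2^n}` onto) at a `2`-split Heegner frame: **the bit «no non-zero
  class of `H¹(ℚ, E[2])` dying on `Γ_{ℚ(E[4])}` is Kummer at `ℚ₂`» implies `(NPh_M)(E, K)` for every `M ≥ 1`** — on the cut by the Tate prime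
  (g31 `nonPhantom_baseChange_of_cut`, the bit idle), off the cut by the `TwoAdic` criterion.
* ★★ `kFourNeg_conclusion_of_depth_one_of_twoAdicBit` — **the conclusion of `K4Neg` on its depth-one sub-cell (`M₀ = 1`), binders = item 33814
  `K4NegDepthOneOnCut` WITHOUT its four cut binders, PLUS the bit `hbit`**, modulo Q2: the LEAD's B2Q♭ with `FrobEqFrobInfty` pair supply
  (`exists_primitive_of_two_pow_pred_smul_ne_zero_of_nonPhantom_of_pairSupply`, `pairSupply_frobEqFrobInfty_of_Δ_neg`) fed with `(NPh_K)` from the bit.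
READING (census; nothing closed): on the K₄⁻ cell, DEPTH ONE = Q2 + «`ξ_E ∉ 𝓛₂`» (one local `2`-descent datum per curve); the kit falsifier of (642)(2)
decides that bit curve by curve.  BSD is NOT proved by any of this.

References: [McCallumLMS1991] §5 Lemma 5.3, Thm. 5.4; [Kolyvagin1989Izv] Thm. B₂, §3; [GrossLMS1991] §3 (3.2), §9; [LawsonWuthrich2016] §7.1, §8;
[MilneADT2006] I Cor. 2.3, Thm. 2.8.
-/

set_option autoImplicit false
set_option linter.dupNamespace false -- `Summit.<P>.<Sub>` repeats `BirchSwinnertonDyer` (D-0017)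

noncomputable section

open scoped Classical NumberField

namespace Summit.BirchSwinnertonDyer.BirchSwinnertonDyer.Theorems.GenusExact.Lw2PhantomExclusion.TwoAdic

open WeierstrassCurve Field NumberField IsDedekindDomain Rat.HeightOneSpectrum
open Literature.NumberTheory.EllipticCurves Literature.NumberTheory.GaloisRepresentations Literature.NumberTheory.EllipticCurves.ModularForms
open Summit.BirchSwinnertonDyer.BirchSwinnertonDyer.Theses.GenusKolyvaginAtTwo (KolyvaginRelationAtTwo)
open Summit.BirchSwinnertonDyer.Rank1Residual
open Summit.BirchSwinnertonDyer.BirchSwinnertonDyer.Theorems.GenusExact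
open Summit.BirchSwinnertonDyer.BirchSwinnertonDyer.Theorems.GenusSupplyNarrow
open Summit.BirchSwinnertonDyer.BirchSwinnertonDyer.Theorems.GenusExact.PlusDescent
  (exists_primitive_of_two_pow_pred_smul_ne_zero_of_nonPhantom_of_pairSupply pairSupply_frobEqFrobInfty_of_Δ_neg
    natCast_pow_dvd_natCast_pow)

/-! ## §9 `(NPh_K)` from the 2-adic bit, on or off the cut -/

/-- ★ **THE 2-ADIC BIT IMPLIES `(NPh_K)` — any sign, on or off the cut.**  `W/ℚ` globally minimal elliptic, `C(W)` odd, `ρ_{E,2^n}` onto; `K` imaginary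
quadratic, `d_K` odd, the two B₂ non-squares, Heegner for `N_W`, `2` split.  If no non-zero class of `H¹(ℚ, E[2])` dying on `Γ_{ℚ(E[4])}` is a Kummer class
at `ℚ₂` (the place `v₂`), then `(NPh_M)(W, K)` holds for every `M ≥ 1`.  With an odd multiplicative prime the conclusion holds outright (Tate witness,
`nonPhantom_baseChange_of_cut`); without one it is the `TwoAdic` criterion. [cite: LawsonWuthrich2016, §7.1, §8] [cite: GrossLMS1991, §9 Prop. 9.1] -/
theorem nonPhantom_pow_of_twoAdicBit (W : WeierstrassCurve ℚ) [W.IsElliptic] [W.IsGloballyMinimal] [NeZero (W.conductorNorm ℤ)]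
    {K : Type} [Field K] [NumberField K]
    (hρ : ∀ n : ℕ, 0 < n → W.HasSurjectiveModNGaloisRep ((2 : ℤ) ^ n)) (hT : Odd W.tamagawaProduct)
    (hK : IsImaginaryQuadratic K) (hodd : Odd (NumberField.discr K)) (hnsq₁ : ¬ IsSquare ((NumberField.discr K : ℚ) * -|W.Δ|))
    (hnsq₂ : ¬ IsSquare ((NumberField.discr K : ℚ) * (-(2 * |W.Δ|))))
    (hH : SatisfiesHeegnerHypothesis (W.conductorNorm ℤ) K) (h2 : ((Ideal.span {(2 : ℤ)}).primesOver (𝓞 K)).ncard = 2)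
    (hbit : ∀ x : galH1Torsion W (2 : ℤ), x ≠ 0 → (∀ h ∈ torsionFixing W (4 : ℤ), h1Eval W (2 : ℤ) x h = 0) →
      x ∉ selmerLocalKer W ((primesEquiv.symm ⟨2, Nat.prime_two⟩ : HeightOneSpectrum (𝓞 ℚ)).adicCompletion ℚ) (2 : ℤ)) :
    ∀ (Mlev : ℕ), 1 ≤ Mlev → ∀ z : galH1Torsion (W.baseChange K) ((2 ^ Mlev : ℕ) : ℤ),
      (∀ ρ ∈ torsionFixing (W.baseChange K) ((2 ^ Mlev : ℕ) : ℤ), h1Eval (W.baseChange K) ((2 ^ Mlev : ℕ) : ℤ) z ρ = 0) →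
      (∀ w : HeightOneSpectrum (𝓞 K), ((2 * W.conductorNorm ℤ : ℕ) : 𝓞 K) ∈ w.asIdeal →
        z ∈ selmerLocalKer (W.baseChange K) (w.adicCompletion K) ((2 ^ Mlev : ℕ) : ℤ)) → z = 0 := by
  by_cases hoff : ∃ v : HeightOneSpectrum (𝓞 ℚ), ((2 : ℕ) : 𝓞 ℚ) ∉ v.asIdeal ∧ ((W.conductorNorm ℤ : ℕ) : 𝓞 ℚ) ∈ v.asIdeal ∧
      W.HasMultiplicativeReductionAt v
  · exact nonPhantom_baseChange_of_cut W hT hρ K hK hodd hH hnsq₁ hnsq₂ hoff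
  · exact (nonPhantom_pow_iff_forall_not_mem_selmerLocalKer_two_of_offCut W hρ hT hoff hK hodd hnsq₁ hnsq₂ hH h2).mpr hbit

/-! ## §10 ★★ K₄⁻ on its depth-one sub-cell, cut-free, modulo Q2 and the bit -/

/-- ★★ **K4Neg ON ITS DEPTH-ONE SUB-CELL, CUT-FREE, modulo Q2 and the 2-adic bit** — item 33814 `K4NegDepthOneOnCut`'s binders with the four cut binders
(`v`, `2 ∉ v`, `N ∈ v`, multiplicative at `v`) DELETED and ONE hypothesis `hbit` («the Lawson–Wuthrich class of `E` is not a Kummer class at `ℚ₂`»)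
ADDED: habitat, `Δ < 0`, `#Sel₂(E) = 4`, PRIME Heegner frame with `2` split, odd-Manin datum, `2^{M₀} ∥ P(1)` with `M₀ = 1`, Sel₂-minimal rank-`1` twin
with `ord₂ C(Wd) ≤ 1` ⊢ the conclusion of K4Neg.  Proof: `(NPh_K)` from the bit (§9); a non-zero `s₀ ∈ Sel₂(E/ℚ)` moved to level `2^{1+1+1}`; the
LEAD's B2Q♭ with the `FrobEqFrobInfty` pair supply of the `Δ < 0` habitat.  GK2-internal (no WALL, no U₂).  BSD is NOT proved by this; K4Neg (depth
`≥ 2`, and depth one without the bit) is NOT closed by this. [cite: McCallumLMS1991, §5 Thm. 5.4] [cite: Kolyvagin1989Izv, Thm. B₂] [cite: GrossLMS1991, §3 (3.2)] -/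
theorem kFourNeg_conclusion_of_depth_one_of_twoAdicBit (hQ2 : KolyvaginRelationAtTwo)
    (W : WeierstrassCurve ℚ) [W.IsElliptic] [W.IsGloballyMinimal] [NeZero (W.conductorNorm ℤ)] (hcm : ¬ W.HasCM) (hr0 : W.analyticRank = 0)
    (hρ : ∀ n : ℕ, 0 < n → W.HasSurjectiveModNGaloisRep ((2 : ℤ) ^ n)) (hT : Odd W.tamagawaProduct) (hneg : W.Δ < 0)
    (h4 : Nat.card (W.selmerGroup 2) = 4)
    (K : Type) [Field K] [NumberField K] (hIQ : IsImaginaryQuadratic K) (hodd : Odd (NumberField.discr K))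
    (h3 : NumberField.discr K ≠ -3) (hHe : SatisfiesHeegnerHypothesis (W.conductorNorm ℤ) K)
    (hsq1 : ¬ IsSquare ((NumberField.discr K : ℚ) * -|W.Δ|)) (hsq2 : ¬ IsSquare ((NumberField.discr K : ℚ) * (-(2 * |W.Δ|))))
    (ℓ₀ : ℕ) (_hℓ₀ : ℓ₀.Prime) (_hdK : NumberField.discr K = -(ℓ₀ : ℤ))
    (h2K : ((Ideal.span {(2 : ℤ)}).primesOver (NumberField.RingOfIntegers K)).ncard = 2)
    (hbit : ∀ x : galH1Torsion W (2 : ℤ), x ≠ 0 → (∀ h ∈ torsionFixing W (4 : ℤ), h1Eval W (2 : ℤ) x h = 0) →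
      x ∉ selmerLocalKer W ((primesEquiv.symm ⟨2, Nat.prime_two⟩ : HeightOneSpectrum (𝓞 ℚ)).adicCompletion ℚ) (2 : ℤ))
    (Dt : ModularParametrizationData W (W.conductorNorm ℤ))
    (_hopt : ∀ z ∈ Dt.L.lattice, ∃ w ∈ periodLattice Dt.f, z = (Dt.c : ℂ) * w) (_hc : Odd Dt.c)
    (β : ℤ) (ι : K →+* ℂ) (d₁ : KolyvaginHeegnerData Dt β ι 1) (_hy : ¬ IsOfFinAddOrder d₁.derivedPoint) (M₀ : ℕ)
    (_hdiv : ∃ Q : (W.baseChange (ringClassField K ι 1)).toAffine.Point, ((2 ^ M₀ : ℕ) : ℤ) • Q = d₁.derivedPoint)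
    (hndiv : ¬ ∃ Q : (W.baseChange (ringClassField K ι 1)).toAffine.Point, ((2 ^ (M₀ + 1) : ℕ) : ℤ) • Q = d₁.derivedPoint)
    (hM₀ : M₀ = 1)
    (Wd : WeierstrassCurve ℚ) [Wd.IsElliptic] [Wd.IsGloballyMinimal]
    (_hWd : ∃ C : VariableChange ℚ, C • W.quadraticTwist (NumberField.discr K : ℚ) = Wd) (_hrd : Wd.analyticRank = 1)
    (_hSelWd : Nat.card (Wd.selmerGroup 2) = 2) (_hTam : padicValNat 2 Wd.tamagawaProduct ≤ 1) :
    ∃ (n : ℕ) (d : KolyvaginHeegnerData Dt β ι n), Squarefree n ∧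
      (∀ ℓ ∈ n.primeFactors, Zhang2014.IsKolyvaginPrime (W.conductorNorm ℤ) W K 2 ℓ ∧ 2 ≤ Zhang2014.kolyvaginIndex W 2 ℓ ∧
        FrobEqFrobInfty W K 2 ℓ) ∧
      ¬ ∃ Q : (W.baseChange (ringClassField K ι n)).toAffine.Point, (2 : ℤ) • Q = d.derivedPoint := by
  subst hM₀
  haveI : Fact (Nat.Prime 2) := ⟨Nat.prime_two⟩
  have hw1 : W.rootNumber = 1 :=
    (Literature.Barriers.BirchSwinnertonDyer.even_analyticRank_iff_of_isNewformOf_conductorLevel Dt.isNewformOf).mp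
      (by rw [hr0]; exact Even.zero)
  have hs2 : W.HasSurjectiveModNGaloisRep 2 := by simpa using hρ 1 one_pos
  -- `(NPh_K)` from the bit, in the all-places form B2Q♭ consumes
  have hNPh : ∀ (L : ℕ), 1 ≤ L → ∀ z : galH1Torsion (W.baseChange K) ((2 ^ L : ℕ) : ℤ),
      (∀ ρ' ∈ torsionFixing (W.baseChange K) ((2 ^ L : ℕ) : ℤ), h1Eval (W.baseChange K) ((2 ^ L : ℕ) : ℤ) z ρ' = 0) →
      (∀ w : HeightOneSpectrum (𝓞 K), z ∈ selmerLocalKer (W.baseChange K) (w.adicCompletion K) ((2 ^ L : ℕ) : ℤ)) → z = 0 :=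
    fun L hL z hz hzS ↦ nonPhantom_pow_of_twoAdicBit W hρ hT hIQ hodd hsq1 hsq2 hHe h2K hbit L hL z hz (fun w _ ↦ hzS w)
  -- a non-zero `2`-Selmer class over `ℚ` at level `2 = 2^1`, moved up to level `2^(1+1+1)`
  have hSel' : 1 < Nat.card (selmerGroup W ((2 ^ 1 : ℕ) : ℤ)) := by rw [pow_one, Nat.cast_ofNat, h4]; norm_num
  have hbot : selmerGroup W ((2 ^ 1 : ℕ) : ℤ) ≠ ⊥ := fun h ↦ by rw [h, AddSubgroup.card_bot] at hSel'; exact lt_irrefl _ hSel'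
  obtain ⟨⟨s₀, hs₀⟩, hne⟩ := AddSubgroup.ne_bot_iff_exists_ne_zero.mp hbot
  have hne₀ : ((2 ^ (1 - 1) : ℕ) : ℤ) • s₀ ≠ 0 := by
    rw [Nat.sub_self, pow_zero, Nat.cast_one, one_zsmul]
    rintro rfl
    exact hne (Subtype.ext rfl)
  have hdvd : ((2 ^ 1 : ℕ) : ℤ) ∣ ((2 ^ (1 + 1 + 1) : ℕ) : ℤ) := natCast_pow_dvd_natCast_pow (p := 2) (by omega)
  have hinj : Function.Injective (torsionH1OfDvd W hdvd) :=
    VisiblePairAtTwo.torsionH1OfDvd_pow_injective W (p := 2) (VisiblePairAtTwo.torsionBy_two_eq_bot_of_surj W hs2) hdvd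
  have hs₀' : torsionH1OfDvd W hdvd s₀ ∈ selmerGroup W ((2 ^ (1 + 1 + 1) : ℕ) : ℤ) := torsionH1OfDvd_mem_selmerGroup W hdvd hs₀
  have hne' : ((2 ^ (1 - 1) : ℕ) : ℤ) • torsionH1OfDvd W hdvd s₀ ≠ 0 := fun h ↦
    hne₀ (hinj (by rw [map_zsmul, map_zero, h]))
  obtain ⟨ℓ, d, hkol, hidx, hΦ, -, -, -, hwit⟩ :=
    exists_primitive_of_two_pow_pred_smul_ne_zero_of_nonPhantom_of_pairSupply (fun ℓ ↦ FrobEqFrobInfty W K 2 ℓ) hQ2 W hcm hT K hIQ hodd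
      h3 hHe hρ hNPh Dt β ι d₁ 1 hndiv hw1 (pairSupply_frobEqFrobInfty_of_Δ_neg W hcm hneg K hIQ hsq1 hρ) (1 + 1 + 1) (by omega) _ hs₀' hne'
  have hℓp : ℓ.Prime := hkol.1
  refine ⟨1 * ℓ, d, by rw [one_mul]; exact hℓp.squarefree, fun q hq ↦ ?_, hwit⟩
  rw [one_mul, hℓp.primeFactors, Finset.mem_singleton] at hq
  subst hq
  exact ⟨hkol, le_trans (by omega) hidx, hΦ⟩

end Summit.BirchSwinnertonDyer.BirchSwinnertonDyer.Theorems.GenusExact.Lw2PhantomExclusion.TwoAdic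

end
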